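import Summits.ValiantsHypothesis.ValiantsHypothesis.Theses.GeneratorObstructions

/-!
# Route GeneratorObstructions — support item `CruxesToThesis`

Pure logic: the two degree cruxes K1 = `PerGenDegreeSuperQP` (the permanent's covariant algebra
keeps acquiring generators beyond every quasi-polynomial degree) and K2 = `PowGenDegreeQP`
(the trace-power side is generated in quasi-polynomial degree inside the window), together with
the inheritance statement `GenInheritance`, imply the route target `GenFlipThesis`
(a degree-overflow generator flip `γ_χ'(tr X^m) = 0 < γ_χ'(per_m)`).
-/

-- `Summit.ValiantsHypothesis.ValiantsHypothesis.…` is the tree's mandated single-conjunct layout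
-- (Sub = Summit), so the duplicated namespace component is intended.
set_option linter.dupNamespace false

namespace Summit.ValiantsHypothesis.ValiantsHypothesis.Theorems.GeneratorObstructions

open Summit.ValiantsHypothesis.ValiantsHypothesis.Theses.GeneratorObstructions

/-- **CruxesToThesis** (route GeneratorObstructions, item stmt-ValiantsHypothesis-11662):
`PerGenDegreeSuperQP → PowGenDegreeQP → GenInheritance → GenFlipThesis`.

Proof: given `c, m₀`, take `c₀` from K2 at `c`, then `(m, χ)` from K1 at exponent `c₀` beyond
`max m₀ 1`; for `n = m + e` in the window inherit `χ` to `χ'` of the same size with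
`γ_χ'(per_m) ≠ 0`; if `γ_χ'(per_m) ≤ γ_χ'(tr X^m)` then `γ_χ'(tr X^m) ≠ 0` and K2's degree bound
`-|χ'| ≤ m·2^((log₂ m + c₀)^c₀)` contradicts K1's `m·2^((log₂ m + c₀)^c₀) < -|χ|`. -/
theorem cruxesToThesis_proof :
    Summit.ValiantsHypothesis.ValiantsHypothesis.Theses.GeneratorObstructions.CruxesToThesis := by
  unfold CruxesToThesis
  intro hK1 hK2 hInh c m₀
  obtain ⟨c₀, hc₀⟩ := hK2 c
  obtain ⟨m, hm, χ, hγ, hdeg⟩ := hK1 c₀ (max m₀ 1)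
  have hm₀ : m₀ ≤ m := le_trans (le_max_left _ _) hm
  have h1m : 1 ≤ m := le_trans (le_max_right _ _) hm
  refine ⟨m, hm₀, h1m, fun e he => ?_⟩
  obtain ⟨χ', hsize, hγ'⟩ := hInh m e h1m χ hγ
  refine ⟨χ', ?_⟩
  refine lt_of_not_ge fun hle => ?_
  have hne := (Nat.lt_of_lt_of_le (Nat.pos_of_ne_zero hγ') hle).ne'
  have hb := hc₀ m e h1m he χ' hne
  rw [hsize] at hb
  exact absurd (lt_of_lt_of_le hdeg hb) (lt_irrefl _)

end Summit.ValiantsHypothesis.ValiantsHypothesis.Theorems.GeneratorObstructions
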